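import Summits.QuantumFields.BalabanUV.Beta.SymCorrectorPairGaugeVertex

/-!
# `BalabanUV.Beta.SymCorrectorMixedGauge` — binder row D1, road «BF-x» junction (J1), brick TT13: **THE MIXED (field–multiplier) FACE PIECE OF THE CHART
# TRANSPORT IS THE MULTIPLIER HALF OF THE OWNER's `Wmix`** — under the rooted slot Ward letter of the FIELD slot of a field–multiplier table (partner = the
# multiplier table), the face piece of TT6 `SymCorrectorRest.mixOfK_conj_psiKS`'s `slotPsiS r n M₂` is a diagonal contact `[M ρ w, θ κ u]`, and its mixed
# bi-vertex through ANY `K` is `conjV (vertexOfM K n M ν y′) (Θ μ y)` — the `[Λ μ y, V^M ν y′]` letter of `D1BFx/ColumnGaugeInvariance.hessKer_columnGauge`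
# for the MULTIPLIER part `V^M := vertexOfM` of the first-order vertex `dM = vertexOfK + vertexOfM` (sequel of TT10∕TT11∕TT12, imports TT12; OWNER N-g23-2 (β′))

THE MATHEMATICS.  The second-order background family `W2OfK` (an2's `SecondOrderResponse`) carries, besides the bi-vertex `vertex2OfK` (TT11∕TT12), two MIXED
words `mixOfK K n M₂ μ y ν y′ + mixOfK K n M₂ ν y′ μ y`, `mixOfK K n M₂ μ y ν y′ := vertexOfK K n (κ u ↦ vertexOfM K n (M₂ κ u) ν y′) μ y`; under the chart
transport only the FIELD slot `(κ, u)` of `M₂` is moved (TT6 `mixOfK_conj_psiKS`: `mixOfK (Ψ̂KΨ̂ᵀ) n M₂ = mixOfK K n (slotPsiS r n M₂)`, the multiplier column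
`colM` does not see the corrector).  With the POINTWISE rooted slot Ward letter of the field slot against the MULTIPLIER table `M`,
`hM : ∀ ρ w u′, divV (κ u ↦ M₂ κ u ρ w) u′ = ξ • conjV (M ρ w) (diagK (legInd ϱ u′))` (for a genuine mixed second-partials table `∂_U ∂_φ 𝕄` this is the gauge
covariance of the first multiplier partials; a HYPOTHESIS here):
* §1 `vertexOfM_conjV_diagK_fixed` (entrywise, no summability: `vertexOfM K n (ρ w ↦ conjV (M ρ w) (diagK g)) ν y′ = conjV (vertexOfM K n M ν y′) (diagK g)`), `faceSumFM_apply`;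
* §2 under `hM`: the face piece `faceWt r n κ u • (faceSum n M₂ (blk n u)) ρ w = conjV (M ρ w) (θ κ u)`, `θ κ u := diagK (z b ↦ [blk n (legSite ϱ z b) = blk n u]·(ξ·faceWt r n κ u))`,
  and `slotPsiS r n M₂ = M₂ + (that)` as families;
* §3 LETTER-FREE: `mixOfK K n (κ u ρ w ↦ conjV (M ρ w) (θ κ u)) μ y ν y′ = conjV (vertexOfM K n M ν y′) (Θ μ y)`, `Θ μ y := diagK (z b ↦ Σ_α Σ_{x ∈ blockSitesF n (blk n (legSite ϱ z b))}
  colH K n μ y α x·c α x)` (TT10's dressed block symbol; inner §1, outer TT10 `vertexOfK_blockContact_eq_conjV`);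
* §4 ASSEMBLED (spread `K`, `LocStencilFM n M₂`, entrywise bounded `M`, `hM`; an2's `mixOfK_add_of_bdd`):
  **`mixOfK K n (slotPsiS r n M₂) μ y ν y′ = mixOfK K n M₂ μ y ν y′ + conjV (vertexOfM K n M ν y′) (Θ μ y)`** and, with TT6, the same for `mixOfK (Ψ̂∘K∘Ψ̂ᵀ) n M₂ μ y ν y′`
  (both orders of the coarse bonds) — so the two mixed face pieces are `[Λ μ y, V^M ν y′] + [Λ ν y′, V^M μ y]` (`Λ := −Θ`, TT10 `conjV_diagK_eq_comm_neg`), completing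
  with TT12's `[Λ′, V μ y] + [Λ, V′ ν y′]` the OWNER's `Wmix` for the FULL first-order vertex `dM = vertexOfK + vertexOfM`.
NOT here: the response word `dM (K2OfK …)` of `W2OfK` (TT6∕TT8's last (D-R) word) and any `tadpole`-null statement.

HONEST DEPENDENCY (cell records, verbatim): «continuum YM on T⁴ ⇐ BetaPertH ∧ nine spine estimates (0/9 proved); BetaPertH ⇐ (D1) ∧ (D4) ∧
CAP+tail; G-an2-4 gates asym, D1 and NE2/3/4.»  HONEST FRAMING (cell contract, verbatim): «discharging `BetaPertH` makes Bałaban's UV stability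
UNCONDITIONAL — a real constructive-QFT result; it is NOT the continuum limit and NOT the Clay problem.»  THIS MODULE DISCHARGES NOTHING of (K), of
(J1)'s row, of D1 or of the wall: [folklore] identities between OUR kernels BY NAME; `hM` is a HYPOTHESIS (no table's letter proved here).  No definition,
no `def … : Prop`, nothing cited, 0 sorry.  0∕4 row-D1 binders; (K) NOT closed; (J1) = ONE OPEN ROW; NOT D1, NEVER «G-an2-4 closed», NOT `BetaPertH`,
NOT continuum, NOT Clay.

ABSOLUTE RULE (cell charter, verbatim): «No internally-minted statement may enter as a cited fact. Every hypothesis is either kernel-proved in this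
package or a verbatim quotation of a PUBLISHED theorem with page reference. The manuscript(s) under audit are NOT citable for their own disputed
steps — they are the thing under adjudication; programme-internal (2001/route/tribunal) claims are never citable.»

D1 formalisation swarm LEAF 03 (`b2b-balaban-beta-d1-formalise-leaf-03`, gen 30), 2026-08-23; over TT10∕TT11∕TT12, TT6 `SymCorrectorRest`, an2's `SecondOrderResponse` ∕
`SecondOrderRemainderTables` ∕ `DiagonalContact` BY NAME; no existing file touched.
-/

open Finset
open scoped BigOperators
open Literature.MathematicalPhysics.QuantumFieldTheory
open Literature.MathematicalPhysics.QuantumFieldTheory.Balaban1983to89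
open Literature.MathematicalPhysics.QuantumFieldTheory.Balaban1983to89.Beta
open B12Sec2to5 (l1 l1_nonneg)
open ExpKernelCalculus (MKer Decays comp)
open OneStepResolventKernel (Fib wsum)
open OneStepKernelFamily (colH vertexOfK)
open InterLevelTransport (cwsum cwsum_apply)
open SecondOrderResponse (colM vertexOfM mixOfK LocStencilFM)
open KernelWard (divV)
open AffineAveraging (Site box)
open AveragingContours (blk)
open Summit.QuantumFields.BalabanUV.Beta.TameKernelCalculus (Spr trK)
open Summit.QuantumFields.BalabanUV.Beta.ChartConjugation (conjV)
open Summit.QuantumFields.BalabanUV.Beta.BorderedHessian (diagK diagK_apply conjV_diagK_apply)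
open Summit.QuantumFields.BalabanUV.Beta.AveragingWardRootedStencils (legSite legInd)
open Summit.QuantumFields.BalabanUV.Beta.CompositeCorrectorLocality (blockSitesF)
open Summit.QuantumFields.BalabanUV.Beta.SymCorrectorKernel (psiKS)
open Summit.QuantumFields.BalabanUV.Beta.SymCorrectorFace (faceWt faceWtSum faceWtSum_nonneg abs_faceWt_le faceSum slotPsiS)
open Summit.QuantumFields.BalabanUV.Beta.SymCorrectorRest (mixOfK_conj_psiKS abs_mixed_slice_le)
open Summit.QuantumFields.BalabanUV.Beta.SecondOrderRemainderTables (mixOfK_add_of_bdd)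
open Summit.QuantumFields.BalabanUV.Beta.SymCorrectorFaceGauge (faceFamily_eq_conjV_of_letters vertexOfK_blockContact_eq_conjV)
open Summit.QuantumFields.BalabanUV.Beta.SymCorrectorPairGaugeVertex (abs_conjV_diagK_le abs_blockCoeff_le)

namespace Summit.QuantumFields.BalabanUV.Beta.SymCorrectorMixedGauge

noncomputable section

variable {d : ℕ} {n : ℕ}

/-! ## §1 Entrywise linearity of the multiplier-column vertex in the non-diagonal argument -/

/-- [folklore] **THE MULTIPLIER-COLUMN VERTEX OF A FAMILY OF DIAGONAL CONTACTS WITH A FIXED GENERATOR** (any `K`, `n ≠ 0`; no summability — `tsum_mul_right`):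
`vertexOfM K n (ρ w ↦ conjV (M ρ w) (diagK g)) ν y′ = conjV (vertexOfM K n M ν y′) (diagK g)`. -/
theorem vertexOfM_conjV_diagK_fixed [NeZero n] (K : MKer (d + 1) (Fib d)) (M : Fin (d + 1) → Site (d + 1) → MKer (d + 1) (Fib d))
    (g : Site (d + 1) → Fib d → ℝ) (ν : Fin (d + 1)) (y' : Site (d + 1)) :
    vertexOfM K n (fun ρ w => conjV (M ρ w) (diagK g)) ν y' = conjV (vertexOfM K n M ν y') (diagK g) := by
  funext p q a c
  simp only [vertexOfM, cwsum_apply, conjV_diagK_apply]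
  rw [Finset.sum_mul]
  refine Finset.sum_congr rfl fun ρ _ => ?_
  rw [← tsum_mul_right]
  refine tsum_congr fun w => ?_
  ring

/-- [folklore] The function-valued face sum of a field–multiplier table evaluated at a multiplier bond: `(faceSum n M₂ Y) ρ w = faceSum n (κ u ↦ M₂ κ u ρ w) Y`. -/
theorem faceSumFM_apply (M₂ : Fin (d + 1) → Site (d + 1) → Fin (d + 1) → Site (d + 1) → MKer (d + 1) (Fib d)) (Y : Site (d + 1))
    (ρ : Fin (d + 1)) (w : Site (d + 1)) :
    faceSum n M₂ Y ρ w = faceSum n (fun κ u => M₂ κ u ρ w) Y := by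
  simp only [faceSum, Finset.sum_apply, Pi.smul_apply]

/-! ## §2 Under the field-slot letter against the multiplier table: the mixed face piece is a diagonal contact -/

section Letter

variable (hn : 0 < n) (r : Fin (d + 1) → ℕ)
  {M₂ : Fin (d + 1) → Site (d + 1) → Fin (d + 1) → Site (d + 1) → MKer (d + 1) (Fib d)} {M : Fin (d + 1) → Site (d + 1) → MKer (d + 1) (Fib d)}
  {ϱ : Site (d + 1)} {ξ : ℝ}
  (hM : ∀ ρ w u', divV (fun κ u => M₂ κ u ρ w) u' = ξ • conjV (M ρ w) (diagK (legInd ϱ u')))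
include hn hM

/-- [folklore] **THE MIXED FACE PIECE IS A CONTACT OF THE MULTIPLIER TABLE**: under `hM`,
`faceWt r n κ u • (faceSum n M₂ (blk n u)) ρ w = conjV (M ρ w) (diagK (z b ↦ [blk n (legSite ϱ z b) = blk n u]·(ξ·faceWt r n κ u)))`. -/
theorem mixedFace_eq_conjV_of_letters (κ : Fin (d + 1)) (u : Site (d + 1)) (ρ : Fin (d + 1)) (w : Site (d + 1)) :
    faceWt r n κ u • faceSum n M₂ (blk n u) ρ w
      = conjV (M ρ w) (diagK fun z b => if blk n (legSite ϱ z b) = blk n u then ξ * faceWt r n κ u else 0) := by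
  rw [faceSumFM_apply]
  exact faceFamily_eq_conjV_of_letters hn (S := fun κ' u' => M₂ κ' u' ρ w) (hM ρ w) r κ u

/-- [folklore] **THE SLOT-TRANSPORTED FIELD–MULTIPLIER TABLE** as a family: `slotPsiS r n M₂ = κ u ρ w ↦ M₂ κ u ρ w + conjV (M ρ w) (θ κ u)`. -/
theorem slotPsiS_FM_eq_add_contact_of_letters :
    slotPsiS r n M₂ = fun κ u ρ w => M₂ κ u ρ w + conjV (M ρ w) (diagK fun z b => if blk n (legSite ϱ z b) = blk n u then ξ * faceWt r n κ u else 0) := by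
  funext κ u ρ w
  rw [← mixedFace_eq_conjV_of_letters hn r hM κ u ρ w]
  rfl

end Letter

/-! ## §3 Letter-free: the mixed bi-vertex of the contact family -/

/-- [folklore] **THE MIXED BI-VERTEX OF THE CONTACT FAMILY** (any `K`, `n ≠ 0`, any multiplier table `M`, coefficients `c`; no summability hypothesis):
`mixOfK K n (κ u ρ w ↦ conjV (M ρ w) (diagK (z b ↦ [blk n (legSite ϱ z b) = blk n u]·c κ u))) μ y ν y′ = conjV (vertexOfM K n M ν y′) (Θ μ y)`,
`Θ μ y := diagK (z b ↦ Σ_α Σ_{x ∈ blockSitesF n (blk n (legSite ϱ z b))} colH K n μ y α x·c α x)` — the `[Λ μ y, V^M ν y′]` letter. -/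
theorem mixOfK_contact_eq [NeZero n] (hn : 0 < n) (K : MKer (d + 1) (Fib d)) (ϱ : Site (d + 1)) (M : Fin (d + 1) → Site (d + 1) → MKer (d + 1) (Fib d))
    (c : Fin (d + 1) → Site (d + 1) → ℝ) (μ : Fin (d + 1)) (y : Site (d + 1)) (ν : Fin (d + 1)) (y' : Site (d + 1)) :
    mixOfK K n (fun κ u ρ w => conjV (M ρ w) (diagK fun z b => if blk n (legSite ϱ z b) = blk n u then c κ u else 0)) μ y ν y'
      = conjV (vertexOfM K n M ν y') (diagK fun z b => ∑ α : Fin (d + 1), ∑ x ∈ blockSitesF n (blk n (legSite ϱ z b)), colH K n μ y α x * c α x) := by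
  unfold SecondOrderResponse.mixOfK
  have hin : (fun κ u => vertexOfM K n (fun ρ w => conjV (M ρ w) (diagK fun z b => if blk n (legSite ϱ z b) = blk n u then c κ u else 0)) ν y')
      = fun κ u => conjV (vertexOfM K n M ν y') (diagK fun z b => if blk n (legSite ϱ z b) = blk n u then c κ u else 0) := by
    funext κ u
    exact vertexOfM_conjV_diagK_fixed K M _ ν y'
  rw [hin]
  exact vertexOfK_blockContact_eq_conjV hn K (vertexOfM K n M ν y') ϱ c μ y

/-! ## §4 Assembled: the transported mixed word = the raw mixed word + the multiplier half of `Wmix` -/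

section Assembled

variable [NeZero n] (hn : 0 < n) (r : Fin (d + 1) → ℕ) {K : MKer (d + 1) (Fib d)} (hK : Spr K)
  {M₂ : Fin (d + 1) → Site (d + 1) → Fin (d + 1) → Site (d + 1) → MKer (d + 1) (Fib d)} {C₂ δ₂ : ℝ} (hM₂ : LocStencilFM n M₂ C₂ δ₂) (hδ₂ : 0 < δ₂)
  {M : Fin (d + 1) → Site (d + 1) → MKer (d + 1) (Fib d)} {BM : ℝ} (hMb : ∀ ρ w p q a e, |M ρ w p q a e| ≤ BM)
  {ϱ : Site (d + 1)} {ξ : ℝ}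
  (hM : ∀ ρ w u', divV (fun κ u => M₂ κ u ρ w) u' = ξ • conjV (M ρ w) (diagK (legInd ϱ u')))
include hn hK hM₂ hδ₂ hMb hM

/-- [folklore] **THE MIXED BI-VERTEX OF THE SLOT-TRANSPORTED TABLE, ASSEMBLED**: for a spread `K`, a local field–multiplier table, an entrywise bounded multiplier
table and the letter `hM`:
`mixOfK K n (slotPsiS r n M₂) μ y ν y′ = mixOfK K n M₂ μ y ν y′ + conjV (vertexOfM K n M ν y′) (diagK (z b ↦ Σ_α Σ_{x ∈ blockSitesF n (blk n (legSite ϱ z b))} colH K n μ y α x·(ξ·faceWt r n α x)))`. -/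
theorem mixOfK_slotPsiS_eq_add_contact_of_letters (μ : Fin (d + 1)) (y : Site (d + 1)) (ν : Fin (d + 1)) (y' : Site (d + 1)) :
    mixOfK K n (slotPsiS r n M₂) μ y ν y'
      = mixOfK K n M₂ μ y ν y'
        + conjV (vertexOfM K n M ν y')
            (diagK fun z b => ∑ α : Fin (d + 1), ∑ x ∈ blockSitesF n (blk n (legSite ϱ z b)), colH K n μ y α x * (ξ * faceWt r n α x)) := by
  obtain ⟨CK, δK, hδK, hKd⟩ := hK
  have hKex : ∃ δ C : ℝ, 0 < δ ∧ 0 ≤ C ∧ Decays K C δ := ⟨δK, CK, hδK, hKd.nonneg (Sum.inl 0), hKd⟩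
  have b1 : ∀ κ u ρ w p q a e, |M₂ κ u ρ w p q a e| ≤ C₂ := fun κ u ρ w p q a e => abs_mixed_slice_le hM₂ hδ₂.le κ u ρ w p q a e
  have b2 : ∀ (κ : Fin (d + 1)) (u : Site (d + 1)) (ρ : Fin (d + 1)) (w p q : Site (d + 1)) (a e : Fib d),
      |conjV (M ρ w) (diagK fun z b => if blk n (legSite ϱ z b) = blk n u then ξ * faceWt r n κ u else 0) p q a e| ≤ BM * (2 * (|ξ| * faceWtSum r n)) :=
    fun κ u ρ w p q a e => abs_conjV_diagK_le (hMb ρ w) (fun z b => abs_blockCoeff_le hn r ϱ ξ κ u z b) p q a e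
  rw [slotPsiS_FM_eq_add_contact_of_letters hn r hM]
  have e : mixOfK K n (fun κ u ρ w => M₂ κ u ρ w
        + conjV (M ρ w) (diagK fun z b => if blk n (legSite ϱ z b) = blk n u then ξ * faceWt r n κ u else 0)) μ y ν y'
      = mixOfK K n M₂ μ y ν y'
        + mixOfK K n (fun κ u ρ w => conjV (M ρ w) (diagK fun z b => if blk n (legSite ϱ z b) = blk n u then ξ * faceWt r n κ u else 0)) μ y ν y' :=
    mixOfK_add_of_bdd (N := n) hKex (P := M₂)
      (Q := fun κ u ρ w => conjV (M ρ w) (diagK fun z b => if blk n (legSite ϱ z b) = blk n u then ξ * faceWt r n κ u else 0))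
      (fun κ u ρ w p q a e => b1 κ u ρ w p q a e) (fun κ u ρ w p q a e => b2 κ u ρ w p q a e) μ y ν y'
  rw [e, mixOfK_contact_eq hn K ϱ M (fun κ u => ξ * faceWt r n κ u) μ y ν y']

variable {r} (hr : r ∈ box (d + 1) n)
include hr

/-- [folklore] **THE MIXED WORD OF THE CHART TRANSPORT AS A GAUGE LETTER**: for an in-block root offset `r`, `Ψ̂ := psiKS r n`,
`mixOfK (Ψ̂∘K∘Ψ̂ᵀ) n M₂ μ y ν y′ = mixOfK K n M₂ μ y ν y′ + conjV (vertexOfM K n M ν y′) (Θ μ y)` (TT6 `mixOfK_conj_psiKS` + the assembled identity) — read at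
both orders of the coarse bonds this gives the two mixed face pieces `[Λ μ y, V^M ν y′] + [Λ ν y′, V^M μ y]` of the transported `W2OfK`, `Λ := −Θ`, `V^M := vertexOfM K n M`. -/
theorem mixOfK_conj_psiKS_eq_add_contact_of_letters (μ : Fin (d + 1)) (y : Site (d + 1)) (ν : Fin (d + 1)) (y' : Site (d + 1)) :
    mixOfK (comp (comp (psiKS r n) K) (trK (psiKS r n))) n M₂ μ y ν y'
      = mixOfK K n M₂ μ y ν y'
        + conjV (vertexOfM K n M ν y')
            (diagK fun z b => ∑ α : Fin (d + 1), ∑ x ∈ blockSitesF n (blk n (legSite ϱ z b)), colH K n μ y α x * (ξ * faceWt r n α x)) := by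
  rw [mixOfK_conj_psiKS hn hr hK hM₂ hδ₂ μ y ν y']
  exact mixOfK_slotPsiS_eq_add_contact_of_letters hn r hK hM₂ hδ₂ hMb hM μ y ν y'

end Assembled

end

end Summit.QuantumFields.BalabanUV.Beta.SymCorrectorMixedGauge
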